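import Mathlib
import HarnessLib
import Summits.HubbardSuperconductivity.HubbardSuperconductivity.Theorems.KLProgrammeKLRegimeVolumeLimitFlowFramesV17F2

/-!
# Route `KLProgramme` — crux K3, VL child `KLRegimeVolumeLimitV17F2` (stmt-HubbardSuperconductivity-20440): THE REGISTERED STUB TEXT FROM A
# COMMON-FRAME TWO-VOLUME COMPARISON plus a ONE-VOLUME FRAME-MISMATCH STEP (triangle door)
# (cell gate-hubbard-kl, seat hubbard-kl-k3c5-p3 g9, technique «OS-positivity-free direct assembly»)

`stub_vl_nestedFramed` compares the last-scale carriers of `L ∣ L″` EACH AT ITS OWN flow frame `K_V = klFlowFrameU V M β U μ (n_β+1)`.  ROUTE A's (A3)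
may prefer to run the fine volume's comparison at the COARSE frame `K_L` and to move the fine carrier from `K_L` to `K_{L″}` in ONE volume afterwards —
k3c4-p2 g8's exact identity [tree] `…TwoVolumeFrameMismatchResum.klSelfEnergy_frame_sub_eq_mismatch_add_response` (`Σ[T(K₂)] − Σ[T(K₁)] = D(p) + response`,
`D = K₂ ⊖ K₁`, ONE near-identity step with the single-scale mismatch covariance).  This file is the corresponding door — a triangle inequality with merged
thresholds, no analysis:

* **`framedNestedFlowTextV17F2_of_commonFrame_and_mismatch`**: IF, inside the regime binders and under the tower, for every Matsubara integer `n` there are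
  `L₀` and `δ → 0` such that for `L ≥ L₀`, `L ∣ L″`, eventually in the common cutoff, at every label of integer `n` and every pair of momenta with
  `p_{k″} = p_k`:  (i) `‖Σ^{K_L}_L(ω,k) − Σ^{K_L}_{L″}(ω,k″)‖ ≤ δ L` (two volumes, COMMON frame `K_L`) and (ii) `‖Σ^{K_L}_{L″}(ω,k″) − Σ^{K_{L″}}_{L″}(ω,k″)‖ ≤ δ L`
  (ONE volume `L″`, two frames), THEN the stub text holds with rate `2δ`;
* `volumeLimitTextV17F2_of_commonFrame_and_mismatch` — hence the VL child text.

Proofs only; no definition.  References: BGM 2006 §2.4 (2.38); FST 1996 §1.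
-/

noncomputable section

namespace Summit.HubbardSuperconductivity.HubbardSuperconductivity.Theorems.TwoPointAssembly

set_option linter.dupNamespace false -- summit = problem name (single-conjunct summit), D-0017

open Finset Filter Topology Literature.MathematicalPhysics.QuantumLattice Literature.Probability.LatticeModels
open Summit.HubbardSuperconductivity.HubbardSuperconductivity.Theorems.KLRegimeSplit
open Summit.HubbardSuperconductivity.HubbardSuperconductivity.Theorems.KLProgrammeLegKernels

/-- **THE STUB TEXT FROM (i) A COMMON-FRAME TWO-VOLUME COMPARISON AND (ii) A ONE-VOLUME FRAME-MISMATCH STEP** (triangle inequality; thresholds merged).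
[cite: BenfattoGiulianiMastropietro2006, §2.4 (2.38)] -/
theorem framedNestedFlowTextV17F2_of_commonFrame_and_mismatch
    (hD : ∀ (G : GeoConsts) (P : SplitConsts) (Q : EngConsts) (R : RenConsts), G.WF → P.WF → Q.WF → R.WF →
      ∃ c₅ : ℝ, 0 < c₅ ∧ ∀ c : ℝ, 0 < c → c ≤ c₅ → ∃ U₀ : ℝ, 0 < U₀ ∧
        ∀ μ ∈ klWindowC, ∀ U : ℝ, 0 < U → U ≤ U₀ → ∀ β : ℝ, klBetaMin ≤ β → β ≤ Real.exp (c / U ^ 2) →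
          ∀ K : TrigPolyC4v, klPredsV17F2.frameOK R U (nScales β) μ K →
            ∀ (Lstar : ℕ) (Mstar : ℕ → ℕ), TowerP klPredsV17F2 G P Q R β U μ K Lstar Mstar →
              ∀ n : ℤ, ∃ L₀ : ℕ, ∃ δ : ℕ → ℝ, Tendsto δ atTop (𝓝 0) ∧
                ∀ (L : ℕ) [NeZero L], L₀ ≤ L → ∀ (L'' : ℕ) [NeZero L''], L ∣ L'' → ∃ M₀ : ℕ, ∀ (M : ℕ) [NeZero M], M₀ ≤ M →
                  ∀ (ω : MatsubaraIdx M), matsubaraInt M ω = n → ∀ (k : TorusSite 2 L) (k'' : TorusSite 2 L''),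
                    latticeMomentum L'' k'' = latticeMomentum L k →
                      ‖klSelfEnergy L M β U μ (klFlowFrameU L M β U μ (nScales β + 1)) klE0 (nScales β + 1) (ω, k) 0 -
                          klSelfEnergy L'' M β U μ (klFlowFrameU L M β U μ (nScales β + 1)) klE0 (nScales β + 1) (ω, k'') 0‖ ≤ δ L ∧
                      ‖klSelfEnergy L'' M β U μ (klFlowFrameU L M β U μ (nScales β + 1)) klE0 (nScales β + 1) (ω, k'') 0 -
                          klSelfEnergy L'' M β U μ (klFlowFrameU L'' M β U μ (nScales β + 1)) klE0 (nScales β + 1) (ω, k'') 0‖ ≤ δ L) :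
    ∀ (G : GeoConsts) (P : SplitConsts) (Q : EngConsts) (R : RenConsts), G.WF → P.WF → Q.WF → R.WF →
      ∃ c₅ : ℝ, 0 < c₅ ∧ ∀ c : ℝ, 0 < c → c ≤ c₅ → ∃ U₀ : ℝ, 0 < U₀ ∧
        ∀ μ ∈ klWindowC, ∀ U : ℝ, 0 < U → U ≤ U₀ → ∀ β : ℝ, klBetaMin ≤ β → β ≤ Real.exp (c / U ^ 2) →
          ∀ K : TrigPolyC4v, klPredsV17F2.frameOK R U (nScales β) μ K →
            ∀ (Lstar : ℕ) (Mstar : ℕ → ℕ), TowerP klPredsV17F2 G P Q R β U μ K Lstar Mstar →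
              ∀ n : ℤ, ∃ L₀ : ℕ, ∃ ρ : ℕ → ℝ, Tendsto ρ atTop (𝓝 0) ∧
                ∀ (L : ℕ) [NeZero L], L₀ ≤ L → ∀ (L'' : ℕ) [NeZero L''], L ∣ L'' → ∃ M₀ : ℕ, ∀ (M : ℕ) [NeZero M], M₀ ≤ M →
                  ∀ (ω : MatsubaraIdx M), matsubaraInt M ω = n → ∀ (k : TorusSite 2 L) (k'' : TorusSite 2 L''),
                    latticeMomentum L'' k'' = latticeMomentum L k →
                      ‖klSelfEnergy L M β U μ (klFlowFrameU L M β U μ (nScales β + 1)) klE0 (nScales β + 1) (ω, k) 0 -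
                          klSelfEnergy L'' M β U μ (klFlowFrameU L'' M β U μ (nScales β + 1)) klE0 (nScales β + 1) (ω, k'') 0‖ ≤ ρ L := by
  intro G P Q R hG hP hQ hR
  obtain ⟨c₅, hc₅, hc⟩ := hD G P Q R hG hP hQ hR
  refine ⟨c₅, hc₅, fun c hc0 hcc => ?_⟩
  obtain ⟨U₀, hU₀, hU⟩ := hc c hc0 hcc
  refine ⟨U₀, hU₀, fun μ hμ U hU0 hUU β hβmin hβmax K hK Lstar Mstar hT n => ?_⟩
  obtain ⟨L₀, δ, hδ, hDn⟩ := hU μ hμ U hU0 hUU β hβmin hβmax K hK Lstar Mstar hT n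
  refine ⟨L₀, fun L => δ L + δ L, by simpa using hδ.add hδ, fun L _ hL L'' _ hdvd => ?_⟩
  obtain ⟨M₀, hM₀⟩ := hDn L hL L'' hdvd
  refine ⟨M₀, fun M _ hM ω hω k k'' hk => ?_⟩
  obtain ⟨h1, h2⟩ := hM₀ M hM ω hω k k'' hk
  exact (norm_sub_le_norm_sub_add_norm_sub _ _ _).trans (add_le_add h1 h2)

/-- **The VL child text from (i) + (ii)** (∘ `volumeLimitTextV17F2_of_framedNestedFlowText`). [cite: BenfattoGiulianiMastropietro2006, §2.4 (2.38)] -/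
theorem volumeLimitTextV17F2_of_commonFrame_and_mismatch
    (hD : ∀ (G : GeoConsts) (P : SplitConsts) (Q : EngConsts) (R : RenConsts), G.WF → P.WF → Q.WF → R.WF →
      ∃ c₅ : ℝ, 0 < c₅ ∧ ∀ c : ℝ, 0 < c → c ≤ c₅ → ∃ U₀ : ℝ, 0 < U₀ ∧
        ∀ μ ∈ klWindowC, ∀ U : ℝ, 0 < U → U ≤ U₀ → ∀ β : ℝ, klBetaMin ≤ β → β ≤ Real.exp (c / U ^ 2) →
          ∀ K : TrigPolyC4v, klPredsV17F2.frameOK R U (nScales β) μ K →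
            ∀ (Lstar : ℕ) (Mstar : ℕ → ℕ), TowerP klPredsV17F2 G P Q R β U μ K Lstar Mstar →
              ∀ n : ℤ, ∃ L₀ : ℕ, ∃ δ : ℕ → ℝ, Tendsto δ atTop (𝓝 0) ∧
                ∀ (L : ℕ) [NeZero L], L₀ ≤ L → ∀ (L'' : ℕ) [NeZero L''], L ∣ L'' → ∃ M₀ : ℕ, ∀ (M : ℕ) [NeZero M], M₀ ≤ M →
                  ∀ (ω : MatsubaraIdx M), matsubaraInt M ω = n → ∀ (k : TorusSite 2 L) (k'' : TorusSite 2 L''),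
                    latticeMomentum L'' k'' = latticeMomentum L k →
                      ‖klSelfEnergy L M β U μ (klFlowFrameU L M β U μ (nScales β + 1)) klE0 (nScales β + 1) (ω, k) 0 -
                          klSelfEnergy L'' M β U μ (klFlowFrameU L M β U μ (nScales β + 1)) klE0 (nScales β + 1) (ω, k'') 0‖ ≤ δ L ∧
                      ‖klSelfEnergy L'' M β U μ (klFlowFrameU L M β U μ (nScales β + 1)) klE0 (nScales β + 1) (ω, k'') 0 -
                          klSelfEnergy L'' M β U μ (klFlowFrameU L'' M β U μ (nScales β + 1)) klE0 (nScales β + 1) (ω, k'') 0‖ ≤ δ L) :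
    VolumeLimitP2 klPredsV17F2 FinalTwoLegVolLimitEx klWindowC :=
  volumeLimitTextV17F2_of_framedNestedFlowText (framedNestedFlowTextV17F2_of_commonFrame_and_mismatch hD)

end Summit.HubbardSuperconductivity.HubbardSuperconductivity.Theorems.TwoPointAssembly
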